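import Summits.AtomisticToContinuum.BoseEinsteinCondensation.Theses.BECNewtonPolicyIteration
import Summits.AtomisticToContinuum.BoseEinsteinCondensation.Theorems.BECCutLineWeakDisorderFlatModeFromLandscape
import Literature.MathematicalPhysics.QuantumManyBody.PeriodicCondensateCoherence
import Literature.MathematicalPhysics.QuantumManyBody.PeriodicBoseGasFracEnergy
import Mathlib
import HarnessLib

/-!
# Route `BECNewtonPolicyIteration` — support item `FlatModePeriodic` (stmt-AtomisticToContinuum-8959)

The route decl `FlatModePeriodic`, proved as stated: for `L > 0` and a NONNEGATIVE periodic trial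
state `Ψ ∈ PeriodicTrialState (n+1) L` (hypothesis `Ψ X = ‖Ψ X‖`),

  `(n + 1) ≤ condensateOccupation (n+1) L Ψ · ∫_{cell^n} L³ m(Y)² / s(Y)² dY`,

where `m(Y) = ∫_cell |Ψ(x, Y)|² dx`, `s(Y) = ∫_cell |Ψ(x, Y)| dx` (`Y ∈ cell^n` the other particles).

Proof (torus twin of `flatModeFromLandscape_proof`, route `BECCutLineWeakDisorder`): by
`condensateOccupation_succ` and `enorm_integral_slice_eq` (the state being real non-negative),
`condensateOccupation = (n+1) L⁻³ ∫_{cell^n} s²`; by Tonelli on the cell (`lintegral_cellN_succ`)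
`1 = ∫_{cell^{n+1}} |Ψ|² = ∫_{cell^n} m(Y) dY`; pointwise `m = (L^{3/2} m/s) · (L^{-3/2} s)` (where
`s(Y) = 0` also `m(Y) = 0`; `s(Y) < ∞` because the slice `x ↦ Ψ(x, Y)` is continuous on the bounded
cell), so Cauchy–Schwarz in `dY` over `cell^n` gives `1 ≤ (∫ L³ m²/s²) · (∫ L⁻³ s²)` — packaged once
and for all in the abstract lemma `FlatModeFromLandscape.le_mul_lintegral_of_lintegral_eq_one`, here
applied with the measure `volume.restrict (cellN n L)`.

No named facts are used (unconditional).
-/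

noncomputable section

open MeasureTheory Set Filter
open scoped ENNReal NNReal ComplexConjugate

namespace Summit.AtomisticToContinuum.BoseEinsteinCondensation.Theorems

open Literature.MathematicalPhysics.QuantumManyBody.BoseGas
open Summit.AtomisticToContinuum.BoseEinsteinCondensation.Theses.BECNewtonPolicyIteration

/-- **`FlatModePeriodic` (stmt-AtomisticToContinuum-8959), as stated in the route file.**
For `L > 0` and a nonnegative `Ψ ∈ PeriodicTrialState (n+1) L`,
`(n+1) ≤ ⟨Ψ, n₀ Ψ⟩ · ∫_{cell^n} L³ m(Y)²/s(Y)² dY` (Tonelli in `x :: Y` on the cell, `∫ m = 1`,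
Cauchy–Schwarz in `dY`). [folklore] -/
theorem flatModePeriodic_proof : FlatModePeriodic := by
  intro n L hL Ψ hΨ
  have hL3 : 0 < L ^ 3 := by positivity
  have hsq : 0 < Real.sqrt (L ^ 3) := Real.sqrt_pos.2 hL3
  have hΨm : Measurable Ψ.ψ := Ψ.contDiff.continuous.measurable
  -- joint measurability of `(x, Y) ↦ |Ψ(x, Y)|`
  have hjoint : Measurable fun p : Space × Config n =>
      (‖Ψ.ψ (Matrix.vecCons p.1 p.2)‖₊ : ℝ≥0∞) :=
    (hΨm.comp (continuous_fst.matrixVecCons continuous_snd).measurable).nnnorm.coe_nnreal_ennreal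
  -- the slices `x ↦ |Ψ(x, Y)|` are continuous, hence measurable and integrable on the cell
  have hcont : ∀ Y : Config n, Continuous fun x : Space => Ψ.ψ (Matrix.vecCons x Y) := fun Y =>
    Ψ.contDiff.continuous.comp (continuous_id.matrixVecCons continuous_const)
  have hslice : ∀ Y : Config n, Measurable fun x : Space =>
      (‖Ψ.ψ (Matrix.vecCons x Y)‖₊ : ℝ≥0∞) := fun Y =>
    (hcont Y).measurable.nnnorm.coe_nnreal_ennreal
  -- the slice masses `m(Y) = ∫_cell |Ψ(x,Y)|² dx`, `s(Y) = ∫_cell |Ψ(x,Y)| dx` are measurable in `Y`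
  have hm : Measurable fun Y : Config n =>
      ∫⁻ x in cell L, (‖Ψ.ψ (Matrix.vecCons x Y)‖₊ : ℝ≥0∞) ^ 2 :=
    (hjoint.pow_const 2).lintegral_prod_left'
  have hs : Measurable fun Y : Config n =>
      ∫⁻ x in cell L, (‖Ψ.ψ (Matrix.vecCons x Y)‖₊ : ℝ≥0∞) :=
    hjoint.lintegral_prod_left'
  have hsfin : ∀ Y : Config n, ∫⁻ x in cell L, (‖Ψ.ψ (Matrix.vecCons x Y)‖₊ : ℝ≥0∞) ≠ ⊤ :=
    fun Y => (hasFiniteIntegral_iff_enorm.mp (integrableOn_cell (L := L) (hcont Y)).2).ne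
  have hsm : ∀ Y : Config n, ∫⁻ x in cell L, (‖Ψ.ψ (Matrix.vecCons x Y)‖₊ : ℝ≥0∞) = 0 →
      ∫⁻ x in cell L, (‖Ψ.ψ (Matrix.vecCons x Y)‖₊ : ℝ≥0∞) ^ 2 = 0 := by
    intro Y h0
    have h1 := (lintegral_eq_zero_iff (hslice Y)).1 h0
    refine (lintegral_eq_zero_iff ((hslice Y).pow_const 2)).2 ?_
    filter_upwards [h1] with x hx
    simp only [Pi.zero_apply] at hx ⊢
    simp [hx]
  -- normalisation through the slices: `∫_{cell^n} m = ∫_{cell^{n+1}} |Ψ|² = 1`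
  have hnorm : ∫⁻ Y in cellN n L, ∫⁻ x in cell L,
      (‖Ψ.ψ (Matrix.vecCons x Y)‖₊ : ℝ≥0∞) ^ 2 = 1 := by
    rw [← lintegral_cellN_succ L (F := fun X => (‖Ψ.ψ X‖₊ : ℝ≥0∞) ^ 2)
      (hΨm.nnnorm.coe_nnreal_ennreal.pow_const 2)]
    exact Ψ.norm_eq
  -- the constants `c = L^{3/2}`, `C = c² = L³`
  have hc0 : ENNReal.ofReal (Real.sqrt (L ^ 3)) ≠ 0 := by
    rwa [Ne, ENNReal.ofReal_eq_zero, not_le]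
  have hcC : ENNReal.ofReal (Real.sqrt (L ^ 3)) ^ 2 = ENNReal.ofReal (L ^ 3) := by
    rw [← ENNReal.ofReal_pow hsq.le, Real.sq_sqrt hL3.le]
  -- the condensate occupation through `s`: `⟨Ψ, n₀Ψ⟩ = (n+1) ∫_{cell^n} (c⁻¹ s)²`
  have hocc : condensateOccupation (n + 1) L Ψ.ψ = ((n : ℝ≥0∞) + 1) *
      ∫⁻ Y in cellN n L, ((ENNReal.ofReal (Real.sqrt (L ^ 3)))⁻¹ *
        ∫⁻ x in cell L, (‖Ψ.ψ (Matrix.vecCons x Y)‖₊ : ℝ≥0∞)) ^ 2 := by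
    rw [condensateOccupation_succ hL]
    congr 1
    simp_rw [enorm_integral_slice_eq Ψ hΨ, mul_pow, ← ENNReal.inv_pow, hcC,
      ← ENNReal.ofReal_pow hL.le]
    rw [← lintegral_const_mul' _ _ (ENNReal.inv_ne_top.2 (ENNReal.ofReal_pos.2 hL3).ne')]
  rw [Nat.cast_succ, hocc]
  exact FlatModeFromLandscape.le_mul_lintegral_of_lintegral_eq_one
    (μ := volume.restrict (cellN n L)) (ENNReal.ofReal (Real.sqrt (L ^ 3)))
    (ENNReal.ofReal (L ^ 3)) ((n : ℝ≥0∞) + 1) hc0 ENNReal.ofReal_ne_top hcC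
    (G := fun Y => (ENNReal.ofReal (Real.sqrt (L ^ 3)))⁻¹ *
      ∫⁻ x in cell L, (‖Ψ.ψ (Matrix.vecCons x Y)‖₊ : ℝ≥0∞))
    hm hs hsfin hsm (fun _ => rfl) hnorm

end Summit.AtomisticToContinuum.BoseEinsteinCondensation.Theorems

end
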